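import Mathlib
import Literature.Topology.FourManifolds.BranchedDoubleQuotient
import Literature.Topology.FourManifolds.ComplexProjectiveSpace

/-!
# Sketch — crux-ideate stmt-SmoothPoincare4-10507 (AcyclicBisectionRigidity), round 2, ideator 5 (gen 2)

First lemmas of the two cards (re)filed this session:

* §A `achiral-relator-reduction` v2 — the LATTICE LEMMA that delimits the lever `T` (monotone
  achiral reducibility): planar types are homology classes = rows of the hole-incidence matrix;
  (i) `UnimodularTypesAgree` (ℤHS seam ⇒ type multisets agree: `T`'s obstruction is silent),
  (ii) `rows_not_perm_of_span_ne` (different row lattices ⇒ different row multisets: on the torsion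
  sector of a homotopy-sphere bisection the kernels are transverse, the lattices differ, the type
  count of `F·F̄′` is non-zero and `T` is impossible — Disproof §13c is the boundary of the lever's
  domain, not an accident).
* §C `antipodal-unfolding` — the DESCENT statement at `b₂ = 1`, `SmoothDescentCP2`: a smooth
  involution of a manifold diffeomorphic to `ℂℙ²` whose standard-model branched double quotient is
  a homotopy 4-sphere has quotient `S⁴` (anti-holomorphic case = Kuiper–Massey; smooth case open).
-/

open scoped Manifold ContDiff Matrix
open ContinuousMap

noncomputable section

namespace Summit.SmoothPoincare4.SmoothPoincare4.Cruxes.AcyclicBisectionRigidity.Ideas.R2I5g2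

/-! ## §A  `achiral-relator-reduction` v2 — the lattice lemma -/

/-- A `0/1` matrix (hole-incidence matrix `M_F` of a minimal planar positive factorisation `F`:
rows = vanishing cycles, columns = holes `1 … k-1`; row `i` = the TYPE of the `i`-th cycle). -/
def IsZeroOne {n : ℕ} (A : Matrix (Fin n) (Fin n) ℤ) : Prop := ∀ i j, A i j = 0 ∨ A i j = 1

/-- **Unimodular types agree.** Two `0/1` matrices with the same Gram matrix `Aᵀ A = Bᵀ B`
(= two minimal positive factorisations of ONE planar monodromy, by the pair-separation counts
`λ_{ij}` of Disproof §13c) and `det A = ±1` (ℤHS seam) have the same multiset of rows: because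
`B A⁻¹ ∈ O(n, ℤ)` is a signed permutation and the rows are non-zero `0/1` vectors. Consequence:
on the unimodular sector the type obstruction to monotone reducibility vanishes identically. -/
def UnimodularTypesAgree : Prop :=
  ∀ (n : ℕ) (A B : Matrix (Fin n) (Fin n) ℤ), IsZeroOne A → IsZeroOne B →
    Aᵀ * A = Bᵀ * B → IsUnit A.det → ∃ σ : Equiv.Perm (Fin n), ∀ i, B i = A (σ i)

/-- **Different row lattices ⇒ different row multisets** (trivial algebra). With
`Λ_F = span(rows M_F) = ker(H₁(page) → H₁(W₁))`: for a homotopy-sphere bisection with `|det| > 1`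
the two kernels are transverse, so `Λ_F ≠ Λ_{F′}`, so `types(F) ≠ types(F′)`, so the type count of
`F·F̄′` is non-zero and the word is NOT monotone reducible
(Disproof §13c `not_monotoneReducible_of_typeCount_ne_zero`): the lever `T` is impossible on the
WHOLE torsion sector, and lives exactly on the unimodular one. -/
theorem rows_not_perm_of_span_ne {n : ℕ} (A B : Matrix (Fin n) (Fin n) ℤ)
    (h : Submodule.span ℤ (Set.range A) ≠ Submodule.span ℤ (Set.range B)) :
    ¬ ∃ σ : Equiv.Perm (Fin n), ∀ i, B i = A (σ i) := by
  rintro ⟨σ, hσ⟩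
  apply h
  have : Set.range B = Set.range A := by
    ext v
    simp only [Set.mem_range]
    constructor
    · rintro ⟨i, rfl⟩
      exact ⟨σ i, (hσ i).symm⟩
    · rintro ⟨i, rfl⟩
      exact ⟨σ.symm i, by rw [hσ, Equiv.apply_symm_apply]⟩
  rw [this]

/-! ## §C  `antipodal-unfolding` — smooth descent at `b₂ = 1` -/

/-- The standard 4-sphere. -/
local notation "𝕊⁴" => (Metric.sphere (0 : EuclideanSpace ℝ (Fin 5)) 1)

/-- **Smooth descent at `b₂ = 1`** (K3 of card `antipodal-unfolding`, typed over the tree's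
`IsBranchedDoubleQuotient` and `ComplexProjectivePlane`): every smooth involution `σ` of a manifold
`X` diffeomorphic to `ℂℙ²` whose standard-model branched double quotient `q : X → M` is a homotopy
4-sphere has `M ≅ S⁴`. For `σ` anti-holomorphic (a real structure) this is Kuiper 1974 / Massey
1973 (`ℂℙ²/conj ≅ S⁴`) + "every real structure of `ℂℙ²` is conjugate to `conj`" +
Degtyarev–Kharlamov uniqueness of the quotient smoothing
(`Literature.Topology.FourManifolds.DegtyarevKharlamov2000_conjQuotient_unique`); for SMOOTH `σ`
it is open — it is exactly what the line needs after McDuff has recognised the unfolded cover. -/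
def SmoothDescentCP2 : Prop :=
  ∀ (X : Type) [TopologicalSpace X] [T2Space X] [SecondCountableTopology X] [CompactSpace X]
    [ChartedSpace (Fin 2 → ℂ) X] [IsManifold 𝓘(ℝ, Fin 2 → ℂ) ∞ X],
    Nonempty (Diffeomorph 𝓘(ℝ, Fin 2 → ℂ) (𝓡 4) X
      Literature.Topology.FourManifolds.ComplexProjectivePlane ∞) →
    ∀ (σ : X → X), ContMDiff 𝓘(ℝ, Fin 2 → ℂ) 𝓘(ℝ, Fin 2 → ℂ) ∞ σ →
    ∀ (M : Type) [TopologicalSpace M] [T2Space M] [SecondCountableTopology M]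
      [ChartedSpace (EuclideanSpace ℝ (Fin 4)) M] [IsManifold (𝓡 4) ∞ M] (q : X → M),
      Literature.Topology.FourManifolds.IsBranchedDoubleQuotient σ q →
      M ≃ₕ 𝕊⁴ → Nonempty (M ≃ₘ⟮𝓡 4, 𝓡 4⟯ 𝕊⁴)

end Summit.SmoothPoincare4.SmoothPoincare4.Cruxes.AcyclicBisectionRigidity.Ideas.R2I5g2

end
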